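import Mathlib
import HarnessLib
import Summits.QuantumFields.YangMills.Theses.GuardedThresholdRemoval

/-!
# The assembly of route `GuardedThresholdRemoval` (item stmt-QuantumFields-28028), PROVED

`Assembly : PrintShapeRecord → GuardSphereThin → GuardedTransfer → YM3TorusSU2` (rung R3 leaf; no summit is proved here) by induction on
the refinement depth: `n` guarded one-step transfers move `(F, γ)` to `((L, m+n), γ·L^{-n})`, which lies in the print-shape regime
`m + n ≥ m₀(L)`, `γ L^{-n} ≤ γ₀(L)` for `n` large (`tendsto_pow_atTop_nhds_zero_of_lt_one`), exactly the arithmetic of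
`T3ThresholdRemoval.continuumYM3Torus_of_refine_threshold`. [cite: Balaban1987RG1, (0.4)-(0.7) p.253]
-/

namespace Summit.QuantumFields.YangMills.Theses.GuardedThresholdRemoval

open scoped Topology
open Filter MeasureTheory

/-- The route's assembly item, proved: the three cruxes give the rung-R3 leaf `YM3TorusSU2`. [cite: Balaban1987RG1, (0.4)-(0.7) p.253] -/
theorem assembly_holds : Assembly := by
  intro h₁ h₂ h₃
  obtain ⟨γ₂, hγ₂, hthin⟩ := h₂
  refine ⟨γ₂, hγ₂, fun F γ hγ hγle => ?_⟩
  obtain ⟨m₀, γ₀, hγ₀, hrec⟩ := h₁ F.L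
  have hL1 : (1 : ℝ) < F.L := by exact_mod_cast F.hL.2
  have hq0 : 0 ≤ ((F.L : ℝ))⁻¹ := inv_nonneg.mpr (zero_le_one.trans hL1.le)
  have hq1 : ((F.L : ℝ))⁻¹ ≤ 1 := inv_le_one_of_one_le₀ hL1.le
  -- descent along refinements: `n` more refinements reach the print-shape regime
  have key : ∀ (n : ℕ) (F' : Literature.MathematicalPhysics.QuantumFieldTheory.Balaban1983to89.T3ContinuumYM3Torus.T3Family) (γ' : ℝ), F'.L = F.L → 0 < γ' → γ' ≤ γ₂ → m₀ ≤ F'.m + n →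
      γ' * ((F.L : ℝ)⁻¹) ^ n ≤ γ₀ → Literature.MathematicalPhysics.QuantumFieldTheory.Balaban1983to89.T3ContinuumYM3Torus.ContinuumYM3Torus F' Literature.MathematicalPhysics.QuantumFieldTheory.Balaban1983to89.T3UnitLawDensityEML.ℰp γ' := by
    intro n
    induction n with
    | zero =>
      intro F' γ' hL' hγ' hγ'le hm hγ₀'
      exact hrec F' γ' hL' (by simpa using hm) hγ' (by simpa using hγ₀')
    | succ n ih =>
      intro F' γ' hL' hγ' hγ'le hm hγ₀'
      have hγL : 0 < γ' * ((F'.L : ℝ)⁻¹) ^ 1 := by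
        rw [hL']; exact mul_pos hγ' (pow_pos (inv_pos.mpr (zero_lt_one.trans hL1)) 1)
      have hγLle : γ' * ((F'.L : ℝ)⁻¹) ^ 1 ≤ γ₂ := by
        rw [hL', pow_one]
        calc γ' * ((F.L : ℝ))⁻¹ ≤ γ' * 1 := by gcongr
          _ = γ' := mul_one _
          _ ≤ γ₂ := hγ'le
      refine h₃ F' γ' hγ' (hthin (F'.refine 1) _ hγL hγLle) ?_
      refine ih (F'.refine 1) _ (by simpa using hL') hγL hγLle (by simp; omega) ?_
      rw [hL']
      calc γ' * ((F.L : ℝ)⁻¹) ^ 1 * ((F.L : ℝ)⁻¹) ^ n = γ' * ((F.L : ℝ)⁻¹) ^ (n + 1) := by ring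
        _ ≤ γ₀ := hγ₀'
  -- choose the refinement depth
  have hq1' : ((F.L : ℝ))⁻¹ < 1 := inv_lt_one_of_one_lt₀ hL1
  obtain ⟨n, hn⟩ := (((tendsto_pow_atTop_nhds_zero_of_lt_one hq0 hq1').eventually
    (ge_mem_nhds (show (0 : ℝ) < γ₀ / γ from div_pos hγ₀ hγ))).and (eventually_ge_atTop m₀)).exists
  refine key n F γ rfl hγ hγle (le_trans hn.2 (Nat.le_add_left _ _)) ?_
  calc γ * ((F.L : ℝ)⁻¹) ^ n ≤ γ * (γ₀ / γ) := by gcongr; exact hn.1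
    _ = γ₀ := mul_div_cancel₀ _ hγ.ne'

end Summit.QuantumFields.YangMills.Theses.GuardedThresholdRemoval
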